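import Mathlib
import Summits.Ventures.DiscreteObjects.Mahler.DobrowolskiLemma

/-!
# A Lehmer-strength bound for cyclotomic integers (Amoroso–Dvornicich, unramified prime) (venture `DiscreteObjects`, target L)

Cell `pub-namedobj`, seat `pub-namedobj-mahler-g27`. Framing: lottery ticket; floor = certified bounds/negative ranges.

[cite: BombieriGubler2001, Theorem 4.4.9, proof of Case I with Lemma 4.4.13(a)] (Amoroso–Dvornicich, J. Number Theory 80
(2000)): for an algebraic integer `α = g(ζ_m) ∈ ℤ[ζ_m]` of the `m`-th cyclotomic field, not `0` and not a root of unity,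
and a prime `p` NOT dividing `m`, the Frobenius congruence `g(ζ)^p ≡ g(ζ^p) (mod p)` and the product formula give
`h(α) ≥ log(p/2)/(p+1)`.  KERNEL FORM over `ℂ`, with `g ∈ ℤ[X]` and the primitive `m`-th roots of unity `μ`:
**`(p/2)^{φ(m)} ≤ (∏_μ max(1, |g(μ)|))^{p+1}`** (`cyclotomicInteger_measure_bound`) whenever `g(μ)^p ≠ g(μ^p)` for every
primitive `μ` — which holds as soon as `g(ζ_m)` is neither `0` nor a root of unity (`pow_ne_aeval_pow_of_not_torsion`).
Method: `g^p - g(X^p) = p·T` in `ℤ[X]` (`DobrowolskiLemma.exists_expand_eq_prime_mul_add`), so the resultant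
`Res(Φ_m, g^p - g(X^p)) = p^{φ(m)} Res(Φ_m, T)` is a nonzero multiple of `p^{φ(m)}`, while over `ℂ` it is
`∏_μ (g(μ)^p - g(μ^p))`, of modulus `≤ 2^{φ(m)} H^p · H` with `H = ∏_μ max(1,|g(μ)|)` (the map `μ ↦ μ^p` permutes the
primitive roots).  `H = M(F)` for `F = ∏_μ (X - g(μ)) = (minpoly α)^{φ(m)/deg α}`, so this is
`M(α)^{p+1} ≥ (p/2)^{deg α}` (file `CyclotomicIntegerLehmer`).  REPLICATION, no new mathematics.
-/

namespace Summit.Ventures.DiscreteObjects.Mahler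

open Polynomial Finset

/-- `g^p - g(X^p) = p · T` in `ℤ[X]` (Fermat / Frobenius). -/
theorem exists_pow_sub_expand_eq_prime_mul (g : ℤ[X]) {p : ℕ} (hp : p.Prime) :
    ∃ T : ℤ[X], g ^ p - expand ℤ p g = C (p : ℤ) * T := by
  obtain ⟨T, hT⟩ := exists_expand_eq_prime_mul_add g hp
  refine ⟨-T, ?_⟩
  rw [hT, mul_pow_sub_one hp.ne_zero]
  ring

/-- A primitive `m`-th root of unity is fixed by any exponent `≡ 1 (mod m)`. -/
theorem pow_eq_self_of_mod_eq {μ : ℂ} {m e : ℕ} (hm : 0 < m) (hμ : IsPrimitiveRoot μ m) (he : e % m = 1 % m) :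
    μ ^ e = μ := by
  rcases Nat.lt_or_ge 1 m with h1 | h1
  · rw [← Nat.div_add_mod e m, pow_add, pow_mul, hμ.pow_eq_one, one_pow, one_mul, he, Nat.mod_eq_of_lt h1, pow_one]
  · have hm1 : m = 1 := by omega
    subst hm1
    rw [IsPrimitiveRoot.one_right_iff] at hμ
    rw [hμ, one_pow]

/-- The map `μ ↦ μ^p` permutes the primitive `m`-th roots of unity when `p` is prime to `m`. -/
theorem prod_primitiveRoots_pow_eq {m p : ℕ} (hm : 0 < m) (hcop : p.Coprime m) (F : ℂ → ℝ) :
    ∏ μ ∈ primitiveRoots m ℂ, F (μ ^ p) = ∏ μ ∈ primitiveRoots m ℂ, F μ := by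
  -- an exponent `q` with `p q ≡ 1 (mod m)`
  have htot : 0 < m.totient := Nat.totient_pos.2 hm
  set q : ℕ := p ^ (m.totient - 1) with hq
  have hpq : (p * q) % m = 1 % m := by
    have h := Nat.ModEq.pow_totient hcop
    rw [hq, ← pow_succ', Nat.sub_add_cancel htot]
    exact h
  have hqp : (q * p) % m = 1 % m := by rw [mul_comm]; exact hpq
  have hqcop : q.Coprime m := by rw [hq]; exact Nat.Coprime.pow_left _ hcop
  refine Finset.prod_nbij' (fun μ => μ ^ p) (fun ν => ν ^ q) ?_ ?_ ?_ ?_ ?_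
  · intro μ hμ
    exact (mem_primitiveRoots hm).2 (((mem_primitiveRoots hm).1 hμ).pow_of_coprime p hcop)
  · intro ν hν
    exact (mem_primitiveRoots hm).2 (((mem_primitiveRoots hm).1 hν).pow_of_coprime q hqcop)
  · intro μ hμ
    rw [← pow_mul]
    exact pow_eq_self_of_mod_eq hm ((mem_primitiveRoots hm).1 hμ) hpq
  · intro ν hν
    rw [← pow_mul]
    exact pow_eq_self_of_mod_eq hm ((mem_primitiveRoots hm).1 hν) hqp
  · intro μ _
    rfl

/-- Every primitive `m`-th root of unity is a root of every `ℤ`-polynomial that has one primitive `m`-th root of unity as a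
root (irreducibility of `Φ_m` over `ℚ`). -/
theorem aeval_eq_zero_of_primitiveRoot {m : ℕ} (hm : 0 < m) {G : ℤ[X]} {μ : ℂ} (hμ : IsPrimitiveRoot μ m)
    (hG : aeval μ G = 0) {ν : ℂ} (hν : IsPrimitiveRoot ν m) : aeval ν G = 0 := by
  have hdvd : minpoly ℚ μ ∣ G.map (algebraMap ℤ ℚ) := minpoly.dvd ℚ μ (by rwa [aeval_map_algebraMap])
  have h1 : aeval ν (minpoly ℚ μ) = 0 := by
    rw [← cyclotomic_eq_minpoly_rat hμ hm, aeval_def, eval₂_eq_eval_map, map_cyclotomic]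
    haveI : NeZero (m : ℂ) := ⟨by exact_mod_cast hm.ne'⟩
    exact (isRoot_cyclotomic_iff.2 hν)
  obtain ⟨r, hr⟩ := hdvd
  have h2 : aeval ν (G.map (algebraMap ℤ ℚ)) = 0 := by rw [hr, map_mul, h1, zero_mul]
  rwa [aeval_map_algebraMap] at h2

/-- **Separation**: if `g(ζ_m)` is neither `0` nor a root of unity and `p ∤ m` is prime, then `g(μ)^p ≠ g(μ^p)` for every
primitive `m`-th root of unity `μ` (else, by irreducibility of `Φ_m`, `g(ζ)^{p^i} = g(ζ^{p^i})` for all `i`, and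
`p^{φ(m)} ≡ 1 (mod m)` makes `g(ζ)` a root of unity). -/
theorem pow_ne_aeval_pow_of_not_torsion {m p : ℕ} (hm : 0 < m) (hp : p.Prime) (hcop : p.Coprime m) (g : ℤ[X])
    {ζ : ℂ} (hζ : IsPrimitiveRoot ζ m) (h0 : aeval ζ g ≠ 0) (hnu : ∀ k : ℕ, 0 < k → aeval ζ g ^ k ≠ 1) :
    ∀ μ ∈ primitiveRoots m ℂ, aeval μ g ^ p ≠ aeval (μ ^ p) g := by
  intro μ hμ heq
  have hμ' := (mem_primitiveRoots hm).1 hμ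
  set G : ℤ[X] := g ^ p - expand ℤ p g with hG
  have hGμ : aeval μ G = 0 := by
    rw [hG, map_sub, map_pow, expand_aeval, heq, sub_self]
  have hstep : ∀ ν : ℂ, IsPrimitiveRoot ν m → aeval ν g ^ p = aeval (ν ^ p) g := by
    intro ν hν
    have h := aeval_eq_zero_of_primitiveRoot hm hμ' hGμ hν
    rw [hG, map_sub, map_pow, expand_aeval, sub_eq_zero] at h
    exact h
  have hiter : ∀ i : ℕ, aeval ζ g ^ (p ^ i) = aeval (ζ ^ (p ^ i)) g := by
    intro i
    induction i with
    | zero => simp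
    | succ i ih =>
      rw [pow_succ, pow_mul, ih, hstep _ (hζ.pow_of_coprime _ ((Nat.Coprime.pow_left i hcop))), ← pow_mul]
  have hE : (p ^ m.totient) % m = 1 % m := Nat.ModEq.pow_totient hcop
  have key := hiter m.totient
  rw [pow_eq_self_of_mod_eq hm hζ hE] at key
  have htot : 0 < m.totient := Nat.totient_pos.2 hm
  have hge : 2 ≤ p ^ m.totient := by
    calc 2 ≤ p := hp.two_le
      _ = p ^ 1 := (pow_one p).symm
      _ ≤ p ^ m.totient := Nat.pow_le_pow_right hp.pos htot
  have hone : aeval ζ g ^ (p ^ m.totient - 1) = 1 := by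
    have h2 : aeval ζ g ^ (p ^ m.totient - 1) * aeval ζ g = 1 * aeval ζ g := by
      rw [← pow_succ, Nat.sub_add_cancel (by omega), key, one_mul]
    exact mul_right_cancel₀ h0 h2
  exact hnu _ (by omega) hone

/-- `x + y ≤ 2 x y` for `x, y ≥ 1`. -/
theorem add_le_two_mul_mul {x y : ℝ} (hx : 1 ≤ x) (hy : 1 ≤ y) : x + y ≤ 2 * x * y := by nlinarith

/-- **[BombieriGubler2001, Theorem 4.4.9, Case I] for cyclotomic integers, kernel form.**  Let `m ≥ 1`, `p` a prime
not dividing `m`, and `g ∈ ℤ[X]` with `g(μ)^p ≠ g(μ^p)` for every primitive `m`-th root of unity `μ ∈ ℂ`.  Then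
`(p/2)^{φ(m)} ≤ (∏_μ max(1, |g(μ)|))^{p+1}`, the product over the primitive `m`-th roots of unity. -/
theorem cyclotomicInteger_measure_bound {m p : ℕ} (hm : 0 < m) (hp : p.Prime) (hcop : p.Coprime m) (g : ℤ[X])
    (hsep : ∀ μ ∈ primitiveRoots m ℂ, aeval μ g ^ p ≠ aeval (μ ^ p) g) :
    ((p : ℝ) / 2) ^ m.totient ≤ (∏ μ ∈ primitiveRoots m ℂ, max 1 ‖aeval μ g‖) ^ (p + 1) := by
  classical
  set Φ : ℤ[X] := cyclotomic m ℤ with hΦ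
  have hΦmon : Φ.Monic := cyclotomic.monic m ℤ
  have hΦdeg : Φ.natDegree = m.totient := natDegree_cyclotomic m ℤ
  set ζ₀ : ℂ := Complex.exp (2 * Real.pi * Complex.I / m) with hζ₀def
  have hζ₀ : IsPrimitiveRoot ζ₀ m := Complex.isPrimitiveRoot_exp m hm.ne'
  have hΦC : Φ.map (Int.castRingHom ℂ) = ∏ μ ∈ primitiveRoots m ℂ, (X - C μ) := by
    rw [hΦ, map_cyclotomic_int, cyclotomic_eq_prod_X_sub_primitiveRoots hζ₀]
  have hroots : (Φ.map (Int.castRingHom ℂ)).roots = (primitiveRoots m ℂ).val := by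
    rw [hΦC, roots_prod_X_sub_C]
  have hlc : (Φ.map (Int.castRingHom ℂ)).leadingCoeff = 1 := (hΦmon.map _).leadingCoeff
  have hcard : (primitiveRoots m ℂ).card = m.totient := hζ₀.card_primitiveRoots
  -- `G = g^p - g(X^p) = p T`
  obtain ⟨T, hT⟩ := exists_pow_sub_expand_eq_prime_mul g hp
  set G : ℤ[X] := g ^ p - expand ℤ p g with hG
  set N : ℕ := p * g.natDegree with hN
  have hGdeg : G.natDegree ≤ N := by
    rw [hG]
    refine (natDegree_sub_le _ _).trans (max_le ?_ ?_)
    · exact natDegree_pow_le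
    · rw [natDegree_expand, mul_comm]
  have hp0 : (p : ℤ) ≠ 0 := by exact_mod_cast hp.ne_zero
  have hTdeg : T.natDegree ≤ N := by
    have : T.natDegree = G.natDegree := by rw [hT, natDegree_C_mul hp0]
    rw [this]
    exact hGdeg
  -- resultants
  have hRes : Φ.resultant G Φ.natDegree N = (p : ℤ) ^ Φ.natDegree * Φ.resultant T Φ.natDegree N := by
    rw [hT, resultant_C_mul_right]
  have hev : ((Φ.resultant G Φ.natDegree N : ℤ) : ℂ) =
      ∏ μ ∈ primitiveRoots m ℂ, (aeval μ g ^ p - aeval (μ ^ p) g) := by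
    rw [resultant_intCast_eq hGdeg, hlc, one_pow, one_mul, hroots]
    change ∏ μ ∈ primitiveRoots m ℂ, (G.map (Int.castRingHom ℂ)).eval μ = _
    refine Finset.prod_congr rfl fun μ _ => ?_
    rw [eval_map, ← algebraMap_int_eq, ← aeval_def, hG, map_sub, map_pow, expand_aeval]
  have hne : Φ.resultant G Φ.natDegree N ≠ 0 := by
    intro h0
    have h := hev
    rw [h0, Int.cast_zero] at h
    exact (Finset.prod_ne_zero_iff.2 fun μ hμ => sub_ne_zero.2 (hsep μ hμ)) h.symm
  -- lower bound `p^φ ≤ |Res|`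
  have hlow : (p : ℝ) ^ m.totient ≤ ‖((Φ.resultant G Φ.natDegree N : ℤ) : ℂ)‖ := by
    have hT0 : Φ.resultant T Φ.natDegree N ≠ 0 := by
      intro h0
      rw [h0, mul_zero] at hRes
      exact hne hRes
    have h1 : (1 : ℤ) ≤ |Φ.resultant T Φ.natDegree N| := Int.one_le_abs hT0
    rw [Complex.norm_intCast, hRes, ← hΦdeg]
    push_cast
    rw [abs_mul, abs_pow, Nat.abs_cast]
    have h2 : (1 : ℝ) ≤ |(Φ.resultant T Φ.natDegree N : ℝ)| := by exact_mod_cast h1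
    calc (p : ℝ) ^ Φ.natDegree = (p : ℝ) ^ Φ.natDegree * 1 := (mul_one _).symm
      _ ≤ (p : ℝ) ^ Φ.natDegree * |(Φ.resultant T Φ.natDegree N : ℝ)| :=
          mul_le_mul_of_nonneg_left h2 (by positivity)
  -- upper bound `|Res| ≤ 2^φ H^p H`
  set H : ℝ := ∏ μ ∈ primitiveRoots m ℂ, max 1 ‖aeval μ g‖ with hH
  have hH0 : 0 ≤ H := Finset.prod_nonneg fun μ _ => by positivity
  have hup : ‖((Φ.resultant G Φ.natDegree N : ℤ) : ℂ)‖ ≤ 2 ^ m.totient * H ^ p * H := by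
    rw [hev, norm_prod]
    calc ∏ μ ∈ primitiveRoots m ℂ, ‖aeval μ g ^ p - aeval (μ ^ p) g‖
        ≤ ∏ μ ∈ primitiveRoots m ℂ, (2 * (max 1 ‖aeval μ g‖) ^ p * max 1 ‖aeval (μ ^ p) g‖) := by
          refine Finset.prod_le_prod (fun μ _ => norm_nonneg _) fun μ _ => ?_
          have ha : ‖aeval μ g ^ p‖ ≤ (max 1 ‖aeval μ g‖) ^ p := by
            rw [norm_pow]
            exact pow_le_pow_left₀ (norm_nonneg _) (le_max_right _ _) _
          have hb : ‖aeval (μ ^ p) g‖ ≤ max 1 ‖aeval (μ ^ p) g‖ := le_max_right _ _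
          have h1 : (1 : ℝ) ≤ (max 1 ‖aeval μ g‖) ^ p := one_le_pow₀ (le_max_left _ _)
          calc ‖aeval μ g ^ p - aeval (μ ^ p) g‖ ≤ ‖aeval μ g ^ p‖ + ‖aeval (μ ^ p) g‖ := norm_sub_le _ _
            _ ≤ (max 1 ‖aeval μ g‖) ^ p + max 1 ‖aeval (μ ^ p) g‖ := add_le_add ha hb
            _ ≤ 2 * (max 1 ‖aeval μ g‖) ^ p * max 1 ‖aeval (μ ^ p) g‖ :=
                add_le_two_mul_mul h1 (le_max_left _ _)
      _ = 2 ^ m.totient * H ^ p * ∏ μ ∈ primitiveRoots m ℂ, max 1 ‖aeval (μ ^ p) g‖ := by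
          rw [Finset.prod_mul_distrib, Finset.prod_mul_distrib, Finset.prod_const, hcard, Finset.prod_pow]
      _ = 2 ^ m.totient * H ^ p * H := by
          rw [prod_primitiveRoots_pow_eq hm hcop (fun z => max 1 ‖aeval z g‖)]
  -- combine
  have h := hlow.trans hup
  rw [div_pow, div_le_iff₀ (by positivity), pow_succ]
  linarith

end Summit.Ventures.DiscreteObjects.Mahler
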